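import Mathlib.LinearAlgebra.Matrix.Adjugate
import Mathlib.LinearAlgebra.Matrix.NonsingularInverse
import Mathlib.LinearAlgebra.Matrix.Block
import Mathlib.Algebra.Ring.GeomSum
import Mathlib.Data.Fin.Tuple.Basic
import Mathlib.Data.Fintype.Powerset
import Literature.Computability.AlgebraicComplexity.PermanentVsDeterminantProofs
import HarnessLib

/-!
# Grenet's branching program with arc-dependent weights: paths and determinant

Topic `Literature/Computability/AlgebraicComplexity`.  Companion of
`PermanentVsDeterminantProofs.lean` (Grenet's `dc(PER_n) ≤ 2ⁿ - 1`), whose path calculus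
(`Grenet.pow_apply`, `det_one_sub`, `pow_succ_eq_zero`, `adjugate_one_sub`,
`adjugate_one_sub_empty_univ`) is stated for LEVEL-dependent arc weights `w j |S|` on the arc
`S → insert j S` of the subset lattice.  Here the same calculus is redone for an ARBITRARY weight
`w S j` of the arc `S → insert j S` (a "generalised Grenet matrix": Grenet's branching program on
the subsets of `Fin n` in which every arc carries its own weight, e.g. its own linear form); the
proofs go through verbatim, the weight of a path `S → S ∪ {g 0} → S ∪ {g 0, g 1} → ⋯` being the
product of the weights of its arcs `w (S ∪ {g 0, …, g (t-1)}) (g t)`.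

## Content (no definitions; the adjacency matrix enters through the hypothesis `hA`)

* `Grenet.arc_pow_apply` — `(Aᵐ) S T` is the sum over the injective `g : Fin m → α` avoiding `S`
  with `S ∪ im g = T` of `∏ₜ w (S ∪ g({i < t})) (g t)`;
* `Grenet.arc_det_one_sub`, `Grenet.arc_pow_succ_eq_zero`, `Grenet.arc_adjugate_one_sub`,
  `Grenet.arc_adjugate_one_sub_empty_univ` — `det (1 - A) = 1`, `A ^ (n + 1) = 0`,
  `adjugate (1 - A) = ∑_{i ≤ n} Aⁱ`, and its `(∅, univ)` entry is the sum over the orderings `σ`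
  of `Fin n` of the path products `∏ₜ w (σ({i < t})) (σ t)`;
* `Grenet.det_arc_repr` — **the determinant of the generalised Grenet matrix** (the `(univ, ∅)`
  minor of `1 - A` reindexed along `e : Finset (Fin n) ≃ Fin 2ⁿ`, times the sign
  `(-1)^(e univ + e ∅)`, exactly the shape of `Grenet.repr`) **is the sum over the permutations
  `σ` of the path products** `∏ₜ w (σ({i < t})) (σ t)` (for Grenet's weights `w S j = X (j, |S|)`
  this is `PER_n`, `Grenet.isAffineDetRepr_repr`).

The prefix set `σ({i < t})` is written `(univ.filter fun i : Fin n => (i : ℕ) < t).image σ`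
throughout (also in the companion `GrenetPathPotentials.lean`, which normalises scalar arc
weights with constant path products by a diagonal gauge).

## Sources

* B. Grenet, *An upper bound for the permanent versus determinant problem*, manuscript (2011),
  Thm. 1 (key `Grenet2011`); B. Grenet, PhD thesis, ENS Lyon (2012), Lemme 3.17 (key
  `Grenet2012Thesis`) — the branching program and its path sums.
* J. M. Landsberg, N. Ressayre, *Permanent v. determinant: an exponential lower bound assuming
  symmetry*, Differential Geom. Appl. 55 (2017), §2.2, §6 (Grenet-like graded representations)
  (key `LandsbergRessayre2017`).
-/

noncomputable section

open Matrix Finset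

namespace Literature.Computability.AlgebraicComplexity

namespace Grenet

variable {α : Type*} [Fintype α] [DecidableEq α] {R : Type*} [CommRing R]

/-- **Paths in Grenet's branching program with arc-dependent weights.** Let `A` be the weighted
adjacency matrix of the subset lattice of `α` with an arc `S → insert j S` of weight `w S j` for
every `j ∉ S`. Then `(Aᵐ) S T` is the sum, over the injective sequences `g : Fin m → α` avoiding
`S` with `S ∪ im g = T`, of the path products `∏ₜ w (S ∪ g({i < t})) (g t)` (Grenet 2012,
Lemme 3.17, with general weights; `Grenet.pow_apply` is the case `w S j = w' j |S|`).
[cite: Grenet2012Thesis, Lemme 3.17] -/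
theorem arc_pow_apply (w : Finset α → α → R) {A : Matrix (Finset α) (Finset α) R}
    (hA : ∀ S T, A S T = ∑ j, if j ∉ S ∧ T = insert j S then w S j else 0)
    (m : ℕ) (S T : Finset α) :
    (A ^ m) S T = ∑ g : Fin m → α,
      if Function.Injective g ∧ (∀ t, g t ∉ S) ∧ S ∪ univ.image g = T
      then ∏ t : Fin m, w (S ∪ (univ.filter fun i : Fin m => (i : ℕ) < (t : ℕ)).image g) (g t)
      else 0 := by
  induction m generalizing S with
  | zero =>
    simp [Matrix.one_apply, Function.injective_of_subsingleton]
  | succ m ih =>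
    have hcons_image : ∀ (j : α) (g : Fin m → α),
        univ.image (Fin.cons j g : Fin (m + 1) → α) = insert j (univ.image g) := by
      intro j g
      ext a
      simp [Fin.exists_fin_succ, eq_comm]
    have hpre_zero : ∀ g : Fin (m + 1) → α,
        S ∪ (univ.filter fun i : Fin (m + 1) => (i : ℕ) < ((0 : Fin (m + 1)) : ℕ)).image g = S := by
      intro g
      simp
    have hcons_pre : ∀ (j : α) (g : Fin m → α) (t : Fin m),
        S ∪ (univ.filter fun i : Fin (m + 1) => (i : ℕ) < (t.succ : ℕ)).image
            (Fin.cons j g : Fin (m + 1) → α) =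
          insert j S ∪ (univ.filter fun i : Fin m => (i : ℕ) < t).image g := by
      intro j g t
      ext a
      simp only [mem_union, mem_insert, mem_image, mem_filter, mem_univ, true_and,
        Fin.exists_fin_succ, Fin.cons_zero, Fin.cons_succ, Fin.val_zero, Fin.val_succ,
        Nat.succ_lt_succ_iff, Nat.zero_lt_succ]
      tauto
    rw [pow_succ', Matrix.mul_apply]
    calc ∑ U, A S U * (A ^ m) U T
        = ∑ U, ∑ j, (if j ∉ S ∧ U = insert j S then w S j * (A ^ m) U T else 0) := by
          refine sum_congr rfl fun U _ => ?_
          rw [hA, sum_mul]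
          refine sum_congr rfl fun j _ => ?_
          split_ifs <;> simp
      _ = ∑ j, (if j ∉ S then w S j * (A ^ m) (insert j S) T else 0) := by
          rw [sum_comm]
          refine sum_congr rfl fun j _ => ?_
          by_cases hj : j ∈ S
          · rw [if_neg (not_not_intro hj)]
            exact sum_eq_zero fun U _ => if_neg fun h => h.1 hj
          · rw [if_pos hj, sum_eq_single_of_mem (insert j S) (mem_univ _)
              (fun U _ hU => if_neg fun h => hU h.2), if_pos ⟨hj, rfl⟩]
      _ = ∑ j, ∑ g : Fin m → α, (if j ∉ S ∧ (Function.Injective g ∧ (∀ t, g t ∉ insert j S) ∧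
            insert j S ∪ univ.image g = T) then
              w S j * ∏ t : Fin m, w (insert j S ∪
                (univ.filter fun i : Fin m => (i : ℕ) < (t : ℕ)).image g) (g t)
            else 0) := by
          refine sum_congr rfl fun j _ => ?_
          by_cases hj : j ∈ S
          · rw [if_neg (not_not_intro hj)]
            exact (sum_eq_zero fun g _ => if_neg fun h => h.1 hj).symm
          · rw [if_pos hj, ih (insert j S), mul_sum]
            refine sum_congr rfl fun g _ => ?_
            by_cases hg : Function.Injective g ∧ (∀ t, g t ∉ insert j S) ∧
                insert j S ∪ univ.image g = T
            · rw [if_pos hg, if_pos ⟨hj, hg⟩]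
            · rw [if_neg hg, if_neg fun h => hg h.2, mul_zero]
      _ = ∑ p : α × (Fin m → α), (if p.1 ∉ S ∧ (Function.Injective p.2 ∧
            (∀ t, p.2 t ∉ insert p.1 S) ∧ insert p.1 S ∪ univ.image p.2 = T) then
              w S p.1 * ∏ t : Fin m, w (insert p.1 S ∪
                (univ.filter fun i : Fin m => (i : ℕ) < (t : ℕ)).image p.2) (p.2 t)
            else 0) :=
          (Fintype.sum_prod_type' _).symm
      _ = _ := by
          refine Fintype.sum_equiv (Fin.consEquiv fun _ => α) _ _ fun p => ?_
          obtain ⟨j, g⟩ := p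
          rw [show (Fin.consEquiv fun _ => α) (j, g) = Fin.cons j g from rfl]
          have hiff : (Function.Injective (Fin.cons j g : Fin (m + 1) → α) ∧
              (∀ t, (Fin.cons j g : Fin (m + 1) → α) t ∉ S) ∧
              S ∪ univ.image (Fin.cons j g : Fin (m + 1) → α) = T) ↔
              (j ∉ S ∧ (Function.Injective g ∧ (∀ t, g t ∉ insert j S) ∧
              insert j S ∪ univ.image g = T)) := by
            simp only [Fin.cons_injective_iff, Fin.forall_fin_succ, Fin.cons_zero, Fin.cons_succ,
              hcons_image, Set.mem_range, not_exists, mem_insert, not_or, forall_and,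
              union_insert, insert_union]
            tauto
          by_cases hc : j ∉ S ∧ (Function.Injective g ∧ (∀ t, g t ∉ insert j S) ∧
              insert j S ∪ univ.image g = T)
          · rw [if_pos hc, if_pos (hiff.mpr hc), Fin.prod_univ_succ, Fin.cons_zero, hpre_zero]
            congr 1
            refine prod_congr rfl fun t _ => ?_
            rw [Fin.cons_succ, hcons_pre]
          · rw [if_neg hc, if_neg fun h => hc (hiff.mp h)]

/-- With arc-dependent weights too, the weighted adjacency matrix `A` of the subset lattice raises
the cardinality, so `1 - A` is block upper-unitriangular for `Finset.card` and `det (1 - A) = 1`.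
[folklore] -/
theorem arc_det_one_sub (w : Finset α → α → R) {A : Matrix (Finset α) (Finset α) R}
    (hA : ∀ S T, A S T = ∑ j, if j ∉ S ∧ T = insert j S then w S j else 0) :
    (1 - A).det = 1 := by
  have hAST : ∀ S T, T.card ≤ S.card → A S T = 0 := by
    intro S T hle
    rw [hA]
    refine sum_eq_zero fun j _ => if_neg ?_
    rintro ⟨hj, rfl⟩
    rw [card_insert_of_notMem hj] at hle
    omega
  have hT : (1 - A).BlockTriangular Finset.card := by
    intro S T hlt
    have hne : S ≠ T := by
      rintro rfl
      exact lt_irrefl _ hlt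
    rw [Matrix.sub_apply, Matrix.one_apply_ne hne, hAST S T hlt.le, sub_zero]
  rw [hT.det]
  refine prod_eq_one fun c _ => ?_
  rw [show (1 - A).toSquareBlock Finset.card c = 1 from ?_, Matrix.det_one]
  ext ⟨S, hS⟩ ⟨T, hT'⟩
  rw [Matrix.toSquareBlock_def, Matrix.of_apply, Matrix.sub_apply, hAST S T (by rw [hS, hT']),
    sub_zero, Matrix.one_apply, Matrix.one_apply]
  simp only [Subtype.mk.injEq]

variable {n : ℕ}

/-- For `α = Fin n` the arc-weighted adjacency matrix of the subset lattice satisfies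
`A ^ (n + 1) = 0` (no injective `Fin (n + 1) → Fin n`). [folklore] -/
theorem arc_pow_succ_eq_zero (w : Finset (Fin n) → Fin n → R)
    {A : Matrix (Finset (Fin n)) (Finset (Fin n)) R}
    (hA : ∀ S T, A S T = ∑ j, if j ∉ S ∧ T = insert j S then w S j else 0) :
    A ^ (n + 1) = 0 := by
  ext S T
  rw [arc_pow_apply w hA, Matrix.zero_apply]
  refine sum_eq_zero fun g _ => if_neg ?_
  rintro ⟨hg, -, -⟩
  simpa using Fintype.card_le_of_injective g hg

/-- The adjugate of the unipotent `1 - A` (arc-weighted adjacency matrix `A` of the subset lattice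
of `Fin n`) is its inverse, the finite geometric series `∑_{i ≤ n} Aⁱ`. [folklore] -/
theorem arc_adjugate_one_sub (w : Finset (Fin n) → Fin n → R)
    {A : Matrix (Finset (Fin n)) (Finset (Fin n)) R}
    (hA : ∀ S T, A S T = ∑ j, if j ∉ S ∧ T = insert j S then w S j else 0) :
    (1 - A).adjugate = ∑ i ∈ range (n + 1), A ^ i := by
  have hmul : (1 - A) * ∑ i ∈ range (n + 1), A ^ i = 1 := by
    rw [mul_neg_geom_sum, arc_pow_succ_eq_zero w hA, sub_zero]
  have hinv := Matrix.inv_eq_right_inv hmul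
  rwa [Matrix.inv_def, arc_det_one_sub w hA, Ring.inverse_one, one_smul] at hinv

/-- **The `(∅, univ)` entry of `adjugate (1 - A)` is the full path sum**: the sum over the injective
(equivalently bijective) `g : Fin n → Fin n` of the path products `∏ₜ w (g({i < t})) (g t)`
(Grenet 2012, Lemme 3.17, with general arc weights). [cite: Grenet2012Thesis, Lemme 3.17] -/
theorem arc_adjugate_one_sub_empty_univ (w : Finset (Fin n) → Fin n → R)
    {A : Matrix (Finset (Fin n)) (Finset (Fin n)) R}
    (hA : ∀ S T, A S T = ∑ j, if j ∉ S ∧ T = insert j S then w S j else 0) :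
    (1 - A).adjugate ∅ univ =
      ∑ g : Fin n → Fin n, if Function.Injective g then
        ∏ t : Fin n, w ((univ.filter fun i : Fin n => (i : ℕ) < (t : ℕ)).image g) (g t) else 0 := by
  rw [arc_adjugate_one_sub w hA, Matrix.sum_apply, sum_eq_single_of_mem n (by simp) ?_]
  · rw [arc_pow_apply w hA]
    refine sum_congr rfl fun g _ => ?_
    by_cases hg : Function.Injective g
    · have himg : univ.image g = univ :=
        image_univ_of_surjective (Finite.injective_iff_surjective.mp hg)
      simp [hg, himg]
    · simp [hg]
  · intro i _ hin
    rw [arc_pow_apply w hA]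
    refine sum_eq_zero fun g _ => if_neg ?_
    rintro ⟨hg, -, hT⟩
    rw [empty_union] at hT
    have hcard := card_image_of_injective univ hg
    rw [hT, card_univ, Fintype.card_fin, card_univ, Fintype.card_fin] at hcard
    exact hin hcard.symm

/-- **The determinant of a generalised Grenet matrix is the sum of its path products.** For the
arc-weighted adjacency matrix `A` of the subset lattice of `Fin n` (`n ≠ 0`, `2ⁿ = N + 1`) and an
indexing `e : Finset (Fin n) ≃ Fin (N + 1)`, the `N × N` matrix
`(-1)^(e univ + e ∅) • ((1 - A)` reindexed along `e`, row of `univ` and column of `∅` deleted`)` —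
the shape of `Grenet.repr` — has determinant `∑_{σ ∈ 𝔖ₙ} ∏ₜ w (σ({i < t})) (σ t)`: the deleted minor
is `±` the `(∅, univ)` cofactor (`Matrix.adjugate_fin_succ_eq_det_submatrix`), and `N` is odd.  For
Grenet's weights `w S j = x_{j,|S|}` this is `PER_n` (Grenet 2011, Thm. 1).
[cite: Grenet2011, Thm. 1] -/
theorem det_arc_repr {N : ℕ} (hn : n ≠ 0) (hN : 2 ^ n = N + 1) (e : Finset (Fin n) ≃ Fin (N + 1))
    (w : Finset (Fin n) → Fin n → R) {A : Matrix (Finset (Fin n)) (Finset (Fin n)) R}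
    (hA : ∀ S T, A S T = ∑ j, if j ∉ S ∧ T = insert j S then w S j else 0) :
    ((-1 : R) ^ ((e univ : ℕ) + (e ∅ : ℕ)) •
        ((1 - A).submatrix e.symm e.symm).submatrix (e univ).succAbove (e ∅).succAbove).det =
      ∑ σ : Equiv.Perm (Fin n),
        ∏ t : Fin n, w ((univ.filter fun i : Fin n => (i : ℕ) < (t : ℕ)).image σ) (σ t) := by
  have hadj : ((1 - A).submatrix e.symm e.symm).adjugate (e ∅) (e univ) =
      ∑ σ : Equiv.Perm (Fin n),
        ∏ t : Fin n, w ((univ.filter fun i : Fin n => (i : ℕ) < (t : ℕ)).image σ) (σ t) := by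
    rw [Matrix.adjugate_submatrix_equiv_self, Matrix.submatrix_apply, e.symm_apply_apply,
      e.symm_apply_apply, arc_adjugate_one_sub_empty_univ w hA]
    exact sum_ite_injective fun g : Fin n → Fin n =>
      ∏ t : Fin n, w ((univ.filter fun i : Fin n => (i : ℕ) < (t : ℕ)).image g) (g t)
  rw [Matrix.adjugate_fin_succ_eq_det_submatrix] at hadj
  have hodd : Odd N := by
    have h2 : Even (N + 1) := hN ▸ Nat.even_pow.mpr ⟨even_two, hn⟩
    exact Nat.not_even_iff_odd.mp (Nat.even_add_one.mp h2)
  rw [Matrix.det_smul, Fintype.card_fin, ← pow_mul, pow_mul', hodd.neg_one_pow]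
  exact hadj

end Grenet

end Literature.Computability.AlgebraicComplexity
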